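/-
Copyright: the b2b-balaban T⁴-continuum CRUX team, row NE7b leaf lineage `t4-ne7b-formalise-leaf-03` (gen 149). Project licence.
-/
import Mathlib.Analysis.Normed.Operator.Bilinear
import Mathlib.Analysis.Normed.Operator.Mul

/-!
# THE TWO-SCALE LETTER IS NECESSARY, NOT ONLY SUFFICIENT: kernel coercivity of `Q` on `ker D` + coercivity of the transported form
# `Q[S·, S·]` on `ker D⁺` (the NEXT floor) + criticality of the section `S` (`Q (S k)` and `Q · (S k)` kill `ker D`) ⟹ `Q` is coercive
# on the whole slice `{v : D⁺ (D v) = 0}`, constant `m₂` with `2s²·m₂ ≤ m⁺`, `2m₂ ≤ m` — so along the hard-step tower «the two-scale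
# letters at every scale» and «the floors at every scale» are ONE debt; and the refuter's `ℝ²` witness as a kernel `example`
# (row NE7b, node U5c; the converse of this lineage's `…TransportedFormCoercivity` (TFC), Mathlib only; answers in kind the located remark
# ι-G93-HSAH-1 = ι-G94-HKAH-1 = ι-G93-TFC-1 of PRICING-NE7b: «kernel coercivity does NOT give the next floor — positivity OFF the kernel is
# needed»; [folklore] linear algebra)

Cell `pub-balaban`, sub-cell `t4`, spine estimate NE7b (`T4WeightBudget.RelWeightBound`; the cell's OWN estimate — NOT PRINTED in
[Bałaban 1983–89], NOT PROVED).  Crux-route work under `Spine/NE7b/` by leaf-03 (CRUX team (2), FREEZE (0) crux-prover clause).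
NOTHING of Bałaban's is named, asserted, valued or discharged; no `T4Continuum/Support` leaf typed; no `def`; zero `sorry`.  Imports
Mathlib ONLY (`Normed.Operator.Bilinear ∕ .Mul`) — independent of the `Spine/NE7b` olean frontier; TFC is NOT imported (its forward
direction `kerCoercive_bilinearComp_div` is quoted BY NAME in this docstring only).  The one-liner `D (v − S (D v)) = 0` is this lineage's
`…QuadraticFibreMinimiser.sub_propagator_mem_ker` in an INNER-PRODUCT context (the gate's dedup located it); here `E` is merely normed (§3's
witness lives in the sup norm), so it is a two-word `have` inside the proofs, not a declaration.

WHY.  The hard-step road (AHE → HSCR → … → HSIS ∕ HSTT on the linear side; ALE → KCD → HKB → KCDM → HKAH → HKIS on the KKT side) USES, at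
scale `k`, kernel coercivity `m` of the Hessian ∕ Lagrangian form `Q` on `ker D` (existence of the chart) and NEEDS, at scale `k + 1`,
kernel coercivity `m⁺` of the transported form `Q⁺ = Q[S·, S·]` on `ker D⁺` (`S = σ′(w₀)` the critical section: `D ∘ S = 1` and
`Q (S k)` kills `ker D`).  TFC supplies `m⁺ = m₂∕d²` FROM the two-scale letter «`Q` is `m₂`-coercive on `{v : D⁺(D v) = 0}`».  The pricing
desk located (F632, witness `E = ℝ²`, `D = pr₁`, `V = ½(−x² + y²)`) that kernel coercivity alone does NOT give `m⁺` — the next action can be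
CONCAVE — and booked the floors «on the whole slice, by value, `k`-uniform» as the road's debt (ii).  THIS FILE closes the logical circle:
the two-scale letter is not an artefact of TFC's method but EQUIVALENT DATA — given kernel coercivity and the critical section's two
orthogonality letters, the next floor `m⁺` GIVES BACK the two-scale letter with `m₂ = min(m⁺∕(2s²), m∕2)` (`‖S k‖ ≤ s‖k‖`): split
`v = S(Dv) + (v − S(Dv))`, the second summand lies in `ker D`, the cross terms vanish, and `‖v‖² ≤ 2s²‖Dv‖² + 2‖v − S(Dv)‖²`.  So what the
tower must carry at every scale is exactly ONE positivity letter per scale, in either currency; and the `ℝ²` witness fails BOTH (§3).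

WHAT IS PROVED ([folklore]; `E`, `F`, `F′` real normed spaces, `Q : E →L E →L ℝ` (no symmetry — the two orthogonality letters are
displayed separately; for a symmetric `Q` either gives the other), `D : E →L F`, `S : F →L E`, `D⁺ : F →L F′`).
* §1 `form_split_of_orth` (`Q v v = Q (S(Dv)) (S(Dv)) + Q κ κ`, `κ := v − S(Dv)`, under the two
  orthogonality letters), `norm_sq_le_split` (`‖v‖² ≤ 2s²‖D v‖² + 2‖v − S(D v)‖²`).
* §2 THE CONVERSE **`twoScale_of_kerCoercive_of_nextCoercive`** — `D (S k) = k`, `‖S k‖ ≤ s‖k‖`, `∀ κ, D κ = 0 → m‖κ‖² ≤ Q κ κ`,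
  `∀ k, D⁺ k = 0 → m⁺‖k‖² ≤ Q (S k) (S k)` (= TFC's `Q.bilinearComp S S k k`, `rfl`), `∀ k κ, D κ = 0 → Q (S k) κ = 0 ∧ Q κ (S k) = 0`, and any
  `m₂ ≥ 0` with `2·s²·m₂ ≤ m⁺`, `2·m₂ ≤ m` ⟹ `∀ v, D⁺ (D v) = 0 → m₂‖v‖² ≤ Q v v` — TFC `kerCoercive_bilinearComp_div`'s HYPOTHESIS `hco`
  recovered from its CONCLUSION's shape; **`twoScale_of_kerCoercive_of_nextCoercive_min`** (the same with `m₂ := min (m⁺∕(2s²)) (m∕2)`, `0 < s`).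
* §2b WHERE THE LETTERS COME FROM: **`section_letters_of_augEquiv`** — an equivalence `A : E ≃L F × (ker D)^*` reading `A h = (D h, (Q h)|_{ker D})`
  (AHE `exists_augHessian_equiv_nnreal`'s shape; HSBD's `A_w`, whose `A_w⁻¹ ∘ inl` IS `σ′(w)`) gives `D (S k) = k` and the first orthogonality letter for
  `S := A⁻¹ ∘ inl`; `orth_letters_of_symm` — for a symmetric `Q` (Hessians) the first letter gives both.
* §3 THE WITNESS (`example`s on `E = ℝ × ℝ`, sup norm; `Q(v, w) = v.2·w.2 − v.1·w.1`, `D = fst`, `S = inl`, `D⁺ = 0`): `D ∘ S = 1`; the two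
  orthogonality letters; kernel coercivity with `m = 1`; and `Q (S 1) (S 1) = −1` — so NO `m⁺ ≥ 0` and NO `m₂ ≥ 0` exists: the next floor and
  the two-scale letter fail TOGETHER, as §2 + TFC predict.
* §4 toy: `E = F = ℝ`, `Q = mul`, `D = S = 1`, `D⁺ = 0`, `m = m⁺ = 1`, `s = 1`, `m₂ = 1∕2`.

NOT HERE (honest): the floors ∕ two-scale letters BY VALUE and `k`-uniform for Bałaban's small-field actions ((A3) ∕ (A1c), NC-NE7b-α
UNRULED — [B9] Thm 3.12-class positivity); the symmetric-`Q` packaging; anything of Bałaban's.  BY-NAME EFFECT ON THE WALL: NONE.  NE7b NOT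
PRINTED ∕ NOT PROVED; spine PROVED 0∕9; rung (B)+1 on a FINITE torus — NOT infinite volume, NOT the mass gap, NOT Clay.  HONEST DEPENDENCY:
continuum YM on T⁴ ⇐ BetaPertH ∧ nine spine estimates (0/9 proved); BetaPertH ⇐ (D1) ∧ (D4) ∧ CAP+tail; G-an2-4 gates asym, D1 and NE2∕3∕4.
-/

set_option autoImplicit false

namespace Summit.QuantumFields.BalabanUV.T4Continuum.NE7b.TwoScaleLetterConverse

variable {E F F' : Type*} [NormedAddCommGroup E] [NormedSpace ℝ E] [NormedAddCommGroup F] [NormedSpace ℝ F]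
  [NormedAddCommGroup F'] [NormedSpace ℝ F']

/-! ## §1. The split `v = S(Dv) + (v − S(Dv))` -/

/-- Under the two orthogonality letters the form splits: `Q v v = Q (S(Dv)) (S(Dv)) + Q κ κ`, `κ = v − S(Dv)`. [folklore] -/
theorem form_split_of_orth (Q : E →L[ℝ] E →L[ℝ] ℝ) {D : E →L[ℝ] F} {S : F →L[ℝ] E} (hS : ∀ k, D (S k) = k)
    (horth : ∀ k κ, D κ = 0 → Q (S k) κ = 0 ∧ Q κ (S k) = 0) (v : E) :
    Q v v = Q (S (D v)) (S (D v)) + Q (v - S (D v)) (v - S (D v)) := by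
  have hκ : D (v - S (D v)) = 0 := by rw [map_sub, hS, sub_self]
  obtain ⟨h1, h2⟩ := horth (D v) (v - S (D v)) hκ
  have e : v = S (D v) + (v - S (D v)) := by abel
  conv_lhs => rw [e]
  simp only [map_add, add_apply, h1, h2, add_zero, zero_add]

/-- `‖v‖² ≤ 2s²‖D v‖² + 2‖v − S(D v)‖²` from `‖S k‖ ≤ s‖k‖`. [folklore] -/
theorem norm_sq_le_split {D : E →L[ℝ] F} {S : F →L[ℝ] E} {s : ℝ} (hs : ∀ k, ‖S k‖ ≤ s * ‖k‖) (v : E) :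
    ‖v‖ ^ 2 ≤ 2 * s ^ 2 * ‖D v‖ ^ 2 + 2 * ‖v - S (D v)‖ ^ 2 := by
  have h0 : ‖v‖ ≤ ‖S (D v)‖ + ‖v - S (D v)‖ := by
    have := norm_add_le (S (D v)) (v - S (D v))
    rwa [add_sub_cancel] at this
  have h1 : ‖S (D v)‖ ≤ s * ‖D v‖ := hs (D v)
  have hs0 : 0 ≤ s * ‖D v‖ := (norm_nonneg _).trans h1
  have h2 : ‖v‖ ≤ s * ‖D v‖ + ‖v - S (D v)‖ := h0.trans (add_le_add h1 le_rfl)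
  have h3 : 0 ≤ ‖v - S (D v)‖ := norm_nonneg _
  nlinarith [norm_nonneg v, sq_nonneg (s * ‖D v‖ - ‖v - S (D v)‖)]

/-! ## §2. THE CONVERSE of TFC: the next floor gives back the two-scale letter -/

/-- **THE TWO-SCALE LETTER FROM KERNEL COERCIVITY + THE NEXT FLOOR.**  `D (S k) = k`, `‖S k‖ ≤ s‖k‖`; kernel coercivity
`D κ = 0 → m‖κ‖² ≤ Q κ κ`; the next floor `D⁺ k = 0 → m⁺‖k‖² ≤ Q (S k) (S k)` (TFC's `Q.bilinearComp S S k k` by `rfl`); the critical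
section's orthogonality letters `D κ = 0 → Q (S k) κ = 0 ∧ Q κ (S k) = 0`; and any `0 ≤ m₂` with `2·s²·m₂ ≤ m⁺` and `2·m₂ ≤ m` ⟹
`∀ v, D⁺ (D v) = 0 → m₂‖v‖² ≤ Q v v`. [folklore] -/
theorem twoScale_of_kerCoercive_of_nextCoercive (Q : E →L[ℝ] E →L[ℝ] ℝ) {D : E →L[ℝ] F} {S : F →L[ℝ] E} (Dn : F →L[ℝ] F')
    (hS : ∀ k, D (S k) = k) {s : ℝ} (hs : ∀ k, ‖S k‖ ≤ s * ‖k‖)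
    {m : ℝ} (hco : ∀ κ, D κ = 0 → m * ‖κ‖ ^ 2 ≤ Q κ κ)
    {mn : ℝ} (hcon : ∀ k, Dn k = 0 → mn * ‖k‖ ^ 2 ≤ Q (S k) (S k))
    (horth : ∀ k κ, D κ = 0 → Q (S k) κ = 0 ∧ Q κ (S k) = 0)
    {m₂ : ℝ} (hm₂ : 0 ≤ m₂) (h1 : 2 * s ^ 2 * m₂ ≤ mn) (h2 : 2 * m₂ ≤ m) :
    ∀ v, Dn (D v) = 0 → m₂ * ‖v‖ ^ 2 ≤ Q v v := by
  intro v hv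
  have hκ : D (v - S (D v)) = 0 := by rw [map_sub, hS, sub_self]
  have hsplit := form_split_of_orth Q hS horth v
  have hn := norm_sq_le_split (D := D) hs v
  have hA := hcon (D v) hv
  have hB := hco (v - S (D v)) hκ
  have hDv : 0 ≤ ‖D v‖ ^ 2 := sq_nonneg _
  have hκ2 : 0 ≤ ‖v - S (D v)‖ ^ 2 := sq_nonneg _
  calc m₂ * ‖v‖ ^ 2 ≤ m₂ * (2 * s ^ 2 * ‖D v‖ ^ 2 + 2 * ‖v - S (D v)‖ ^ 2) := mul_le_mul_of_nonneg_left hn hm₂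
    _ = (2 * s ^ 2 * m₂) * ‖D v‖ ^ 2 + (2 * m₂) * ‖v - S (D v)‖ ^ 2 := by ring
    _ ≤ mn * ‖D v‖ ^ 2 + m * ‖v - S (D v)‖ ^ 2 :=
        add_le_add (mul_le_mul_of_nonneg_right h1 hDv) (mul_le_mul_of_nonneg_right h2 hκ2)
    _ ≤ Q (S (D v)) (S (D v)) + Q (v - S (D v)) (v - S (D v)) := add_le_add hA hB
    _ = Q v v := hsplit.symm

/-- **THE SAME WITH THE EXPLICIT CONSTANT** `m₂ := min (m⁺∕(2s²)) (m∕2)` (`0 < s`, `0 ≤ m`, `0 ≤ m⁺`). [folklore] -/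
theorem twoScale_of_kerCoercive_of_nextCoercive_min (Q : E →L[ℝ] E →L[ℝ] ℝ) {D : E →L[ℝ] F} {S : F →L[ℝ] E} (Dn : F →L[ℝ] F')
    (hS : ∀ k, D (S k) = k) {s : ℝ} (hs0 : 0 < s) (hs : ∀ k, ‖S k‖ ≤ s * ‖k‖)
    {m : ℝ} (hm : 0 ≤ m) (hco : ∀ κ, D κ = 0 → m * ‖κ‖ ^ 2 ≤ Q κ κ)
    {mn : ℝ} (hmn : 0 ≤ mn) (hcon : ∀ k, Dn k = 0 → mn * ‖k‖ ^ 2 ≤ Q (S k) (S k))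
    (horth : ∀ k κ, D κ = 0 → Q (S k) κ = 0 ∧ Q κ (S k) = 0) :
    ∀ v, Dn (D v) = 0 → min (mn / (2 * s ^ 2)) (m / 2) * ‖v‖ ^ 2 ≤ Q v v := by
  have hs2 : 0 < 2 * s ^ 2 := by positivity
  refine twoScale_of_kerCoercive_of_nextCoercive Q Dn hS hs hco hcon horth
    (le_min (div_nonneg hmn hs2.le) (by linarith)) ?_ ?_
  · calc 2 * s ^ 2 * min (mn / (2 * s ^ 2)) (m / 2) ≤ 2 * s ^ 2 * (mn / (2 * s ^ 2)) :=
          mul_le_mul_of_nonneg_left (min_le_left _ _) hs2.le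
      _ = mn := by field_simp
  · calc 2 * min (mn / (2 * s ^ 2)) (m / 2) ≤ 2 * (m / 2) := mul_le_mul_of_nonneg_left (min_le_right _ _) zero_le_two
      _ = m := by ring

/-! ## §2b. Where the letters come from: the augmented-Hessian chart (AHE ∕ HSBD's shape) and symmetry -/

/-- **THE SECTION AND THE FIRST ORTHOGONALITY LETTER FROM THE CHART.**  If `A : E ≃L F × (ker D)^*` reads `A h = (D h, (Q h)|_{ker D})`
(AHE `exists_augHessian_equiv_nnreal`'s shape; HSBD's `A_w`) and `S := A⁻¹ ∘ inl` (HSBD's `σ′(w)`), then `D (S k) = k` and `Q (S k)` kills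
`ker D`. [folklore] -/
theorem section_letters_of_augEquiv {Q : E →L[ℝ] E →L[ℝ] ℝ} {D : E →L[ℝ] F} (A : E ≃L[ℝ] F × (D.ker →L[ℝ] ℝ))
    (hA : ∀ h, A h = (D h, (Q h).comp D.ker.subtypeL)) (k : F) :
    D (((A.symm : F × (D.ker →L[ℝ] ℝ) →L[ℝ] E).comp (ContinuousLinearMap.inl ℝ F (D.ker →L[ℝ] ℝ))) k) = k ∧
      ∀ κ, D κ = 0 → Q (((A.symm : F × (D.ker →L[ℝ] ℝ) →L[ℝ] E).comp (ContinuousLinearMap.inl ℝ F (D.ker →L[ℝ] ℝ))) k) κ = 0 := by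
  have happ : ((A.symm : F × (D.ker →L[ℝ] ℝ) →L[ℝ] E).comp (ContinuousLinearMap.inl ℝ F (D.ker →L[ℝ] ℝ))) k = A.symm (k, 0) := rfl
  have hk : A (A.symm (k, 0)) = (k, 0) := A.apply_symm_apply (k, 0)
  rw [hA] at hk
  have h1 : D (A.symm (k, 0)) = k := congrArg Prod.fst hk
  have h2 : (Q (A.symm (k, 0))).comp D.ker.subtypeL = 0 := congrArg Prod.snd hk
  rw [happ]
  refine ⟨h1, fun κ hκ => ?_⟩
  have h3 := congrArg (fun T : D.ker →L[ℝ] ℝ => T ⟨κ, LinearMap.mem_ker.2 hκ⟩) h2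
  simpa using h3

/-- **BOTH ORTHOGONALITY LETTERS FOR A SYMMETRIC FORM** (Hessians are symmetric): the first letter gives the second. [folklore] -/
theorem orth_letters_of_symm {Q : E →L[ℝ] E →L[ℝ] ℝ} (hsymm : ∀ x y, Q x y = Q y x) {D : E →L[ℝ] F} {S : F →L[ℝ] E}
    (h : ∀ k κ, D κ = 0 → Q (S k) κ = 0) : ∀ k κ, D κ = 0 → Q (S k) κ = 0 ∧ Q κ (S k) = 0 :=
  fun k κ hκ => ⟨h k κ hκ, by rw [hsymm]; exact h k κ hκ⟩

/-! ## §3. The witness: kernel coercivity WITHOUT the next floor, and then the two-scale letter fails too -/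

section Witness

/-- The witness form on `ℝ × ℝ`: `Q v w = v.2·w.2 − v.1·w.1` (the Hessian of `½(−x² + y²)`). -/
private theorem witness_apply (v w : ℝ × ℝ) :
    ((ContinuousLinearMap.mul ℝ ℝ).bilinearComp (ContinuousLinearMap.snd ℝ ℝ ℝ) (ContinuousLinearMap.snd ℝ ℝ ℝ) -
        (ContinuousLinearMap.mul ℝ ℝ).bilinearComp (ContinuousLinearMap.fst ℝ ℝ ℝ) (ContinuousLinearMap.fst ℝ ℝ ℝ)) v w =
      v.2 * w.2 - v.1 * w.1 := by
  simp [ContinuousLinearMap.bilinearComp_apply]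

/-- The section: `fst (inl k) = k`. -/
example (k : ℝ) : ContinuousLinearMap.fst ℝ ℝ ℝ (ContinuousLinearMap.inl ℝ ℝ ℝ k) = k := by simp

/-- The two orthogonality letters of the section `inl` against `ker fst = {(0, y)}`. -/
example (k : ℝ) (κ : ℝ × ℝ) (hκ : ContinuousLinearMap.fst ℝ ℝ ℝ κ = 0) :
    ((ContinuousLinearMap.mul ℝ ℝ).bilinearComp (ContinuousLinearMap.snd ℝ ℝ ℝ) (ContinuousLinearMap.snd ℝ ℝ ℝ) -
        (ContinuousLinearMap.mul ℝ ℝ).bilinearComp (ContinuousLinearMap.fst ℝ ℝ ℝ) (ContinuousLinearMap.fst ℝ ℝ ℝ))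
          (ContinuousLinearMap.inl ℝ ℝ ℝ k) κ = 0 ∧
      ((ContinuousLinearMap.mul ℝ ℝ).bilinearComp (ContinuousLinearMap.snd ℝ ℝ ℝ) (ContinuousLinearMap.snd ℝ ℝ ℝ) -
        (ContinuousLinearMap.mul ℝ ℝ).bilinearComp (ContinuousLinearMap.fst ℝ ℝ ℝ) (ContinuousLinearMap.fst ℝ ℝ ℝ))
          κ (ContinuousLinearMap.inl ℝ ℝ ℝ k) = 0 := by
  have h : κ.1 = 0 := by simpa using hκ
  rw [witness_apply, witness_apply]
  simp [h]

/-- KERNEL COERCIVITY with `m = 1`: on `ker fst` the form is `κ.2² = ‖κ‖²` (sup norm). -/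
example (κ : ℝ × ℝ) (hκ : ContinuousLinearMap.fst ℝ ℝ ℝ κ = 0) :
    (1 : ℝ) * ‖κ‖ ^ 2 ≤
      ((ContinuousLinearMap.mul ℝ ℝ).bilinearComp (ContinuousLinearMap.snd ℝ ℝ ℝ) (ContinuousLinearMap.snd ℝ ℝ ℝ) -
        (ContinuousLinearMap.mul ℝ ℝ).bilinearComp (ContinuousLinearMap.fst ℝ ℝ ℝ) (ContinuousLinearMap.fst ℝ ℝ ℝ)) κ κ := by
  have h : κ.1 = 0 := by simpa using hκ
  rw [witness_apply, Prod.norm_def, h]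
  simp [sq]

/-- … but the NEXT FLOOR FAILS: `Q (S 1) (S 1) = −1`, so no `m⁺ ≥ 0` works — the next action `w ↦ −½w²` is concave. -/
example : ((ContinuousLinearMap.mul ℝ ℝ).bilinearComp (ContinuousLinearMap.snd ℝ ℝ ℝ) (ContinuousLinearMap.snd ℝ ℝ ℝ) -
        (ContinuousLinearMap.mul ℝ ℝ).bilinearComp (ContinuousLinearMap.fst ℝ ℝ ℝ) (ContinuousLinearMap.fst ℝ ℝ ℝ))
      (ContinuousLinearMap.inl ℝ ℝ ℝ 1) (ContinuousLinearMap.inl ℝ ℝ ℝ 1) = -1 := by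
  rw [witness_apply]; simp

/-- … and therefore the TWO-SCALE LETTER FAILS as well (with `D⁺ = 0`, i.e. on the whole of `E`): no `m₂ ≥ 0` with
`m₂‖v‖² ≤ Q v v` for all `v` — test `v = (1, 0)`.  TFC's sufficient letter and §2's necessary letter agree. -/
example : ¬ ∃ m₂ : ℝ, 0 ≤ m₂ ∧ ∀ v : ℝ × ℝ, (0 : ℝ →L[ℝ] ℝ) (ContinuousLinearMap.fst ℝ ℝ ℝ v) = 0 →
    m₂ * ‖v‖ ^ 2 ≤
      ((ContinuousLinearMap.mul ℝ ℝ).bilinearComp (ContinuousLinearMap.snd ℝ ℝ ℝ) (ContinuousLinearMap.snd ℝ ℝ ℝ) -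
        (ContinuousLinearMap.mul ℝ ℝ).bilinearComp (ContinuousLinearMap.fst ℝ ℝ ℝ) (ContinuousLinearMap.fst ℝ ℝ ℝ)) v v := by
  rintro ⟨m₂, hm₂, h⟩
  have h1 := h ((1 : ℝ), (0 : ℝ)) (by simp)
  rw [witness_apply, Prod.norm_def] at h1
  simp at h1
  linarith

end Witness

/-! ## §4. Toy -/

/-- Toy: `E = F = F′ = ℝ`, `Q = mul`, `D = S = 1`, `D⁺ = 0`, `m = m⁺ = 1`, `s = 1`, `m₂ = 1∕2`: `½‖v‖² ≤ v·v`. -/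
example : ∀ v : ℝ, (0 : ℝ →L[ℝ] ℝ) (ContinuousLinearMap.id ℝ ℝ v) = 0 →
    (1 / 2 : ℝ) * ‖v‖ ^ 2 ≤ ContinuousLinearMap.mul ℝ ℝ v v :=
  twoScale_of_kerCoercive_of_nextCoercive (ContinuousLinearMap.mul ℝ ℝ) (D := ContinuousLinearMap.id ℝ ℝ)
    (S := ContinuousLinearMap.id ℝ ℝ) (0 : ℝ →L[ℝ] ℝ) (fun _ => rfl) (s := 1) (fun k => by simp)
    (m := 1) (fun κ _ => by rw [ContinuousLinearMap.mul_apply', one_mul, Real.norm_eq_abs, sq_abs, sq])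
    (mn := 1) (fun k _ => by rw [ContinuousLinearMap.mul_apply', one_mul, ContinuousLinearMap.id_apply, Real.norm_eq_abs, sq_abs, sq])
    (fun k κ hκ => by
      have : κ = 0 := by simpa using hκ
      simp [this])
    (m₂ := 1 / 2) (by norm_num) (by norm_num) (by norm_num)

end Summit.QuantumFields.BalabanUV.T4Continuum.NE7b.TwoScaleLetterConverse
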